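import Summits.BirchSwinnertonDyer.BirchSwinnertonDyer.Theses.SmallImageMuTransfer
import Summits.BirchSwinnertonDyer.BirchSwinnertonDyer.Theorems.SmallImageMuTransferMuTransferStubX9MuBookkeeping
import Summits.BirchSwinnertonDyer.BirchSwinnertonDyer.Theorems.SmallImageMuTransferMuTransferX9CoreAssemblyOdd
import Summits.BirchSwinnertonDyer.BirchSwinnertonDyer.Theorems.SmallImageMuTransferMuTransferX9SelmerDualStub
import Literature.NumberTheory.EllipticCurves.Kato2004.EulerSystemClasses
import Literature.NumberTheory.EllipticCurves.Kato2004.IwasawaCohomologyExistsProofs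
import Literature.NumberTheory.EllipticCurves.KatoFineSelmerFiniteProofs
import Literature.NumberTheory.EllipticCurves.SelmerInftyTorsionFiniteProofs
import Literature.NumberTheory.EllipticCurves.PAdicBSDProofs
import Literature.NumberTheory.EllipticCurves.TateModuleContinuityProofs
import HarnessLib

/-!
# Crux `MuTransferX9` of route `SmallImageMuTransfer` (stmt-BirchSwinnertonDyer-19276) — the item
# MODULO ITS LAST REGISTERED STUB and the four PUBLISHED named facts (pre-closer, k6-c2 g4)

Cell `bsd-smallim`, seat `bsd-smallim-k6-c2` (gen 4, the final landing hand).  HONEST FRAMING: a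
REDUCTION theorem only — no definition, no named fact, no `sorry`; nothing is asserted about any curve and
nothing is booked.  `smallImageMuTransfer_MuTransferX9_of_stepsTwoFourOdd` proves the crux decl
`Theses.SmallImageMuTransfer.MuTransferX9` BY NAME from
* the four PUBLISHED inputs of the registered skeleton v6d (sha16 100eb8c6a7ccf73b; = v6c a17c2b579b8fb484
  of k6-c2 g3) as NAMED-FACT binders — `hfineZ : Kato2004.exists_divisibilityInputs_fineQuotient_zeta`
  (Kato 2004 Thm. 12.5/12.6 + (14.9.3)/(17.13.1): the §17.13 package with the fine quotient and the span
  clause; = `stub_inputsX9`), `hred : Kato2004.mem_pSmul_of_red_eq_zero` (Kato §13.8), `hPT :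
  poitouTate_sum_localTatePairing_eq_zero ℚ` (Milne ADT I 4.10 (b)), `hEP : ∀ v,
  localEulerPoincareCharacteristic ℚ_v` (Milne ADT I 2.8) (the three = `stub_factsX9`); and
* `hG34` = the registered OPEN stub `stub_stepsTwoFourOdd` VERBATIM (MU-TRANSFER-PROOF Lemma 2 + STEP 3 +
  STEP 4 on the genuine objects; text = HOME/plan/k6/lines/v6_sig_stub_stepsTwoFourOdd.txt),
through the tree: `Kato2004.nonempty_iwasawaH1Data_holds` (𝐇¹ exists), GV Prop. 3.7
(`exists_iwasawaToPowerSeries_eq_padicLFunction`), the certificate (`not_mem_augIdealP_of_norm_coeff_eq_one`),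
§6 (i) (`exists_isEulerSystemClass_not_mem`), the KERNEL core
`CoreAssembly.stub_coreX9_of_selmerDualOdd_of_stepsTwoFourOdd` (p452034) fed with the PROVED Selmer-side
stub `SelmerDual.stub_selmerDualOdd_holds` (p465845), then `Sel₀[p]` finite ⟹ `X₀/pX₀` finite ⟹
`length_{(p)} X₀ = 0` ⟹ `length_{(p)} X = 0` (`Kato2004.lengthAt_X_le_lengthAt_fine`) ⟹ `μ = 0`.
When `stub_stepsTwoFourOdd` lands as a tree theorem `T`, the closer is the one-liner
`smallImageMuTransfer_MuTransferX9_of_stepsTwoFourOdd hfineZ hred hPT hEP T` (conditional on the four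
published facts — D-0016 NAMED FACTS; the item's conditional surface of record).
PARTITION (D-0054): X9 (A4) × p ∈ {5,7} — reduction toward the K6 crux; closes NONE by itself.

References: K. Kato, Astérisque 295 (2004) Thm. 12.5, 12.6, §13.8, (14.9.3), §17.13 [Kato2004Asterisque];
B. Mazur, K. Rubin, Mem. AMS 799 (2004) §5.3 [MazurRubin2004]; J. S. Milne, *Arithmetic Duality
Theorems* I 2.8, I 4.10 [MilneADT2006]; R. Greenberg, V. Vatsal, Invent. Math. 142 (2000) Prop. 3.7
[GreenbergVatsal2000]; HOME/koly/MU-TRANSFER-PROOF.md §§0–6.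
-/

set_option linter.dupNamespace false
set_option autoImplicit false

noncomputable section

open scoped Classical MatrixGroups ModularForm NumberField
open CongruenceSubgroup WeierstrassCurve Field IsDedekindDomain
open Literature.NumberTheory.GaloisRepresentations
open Literature.NumberTheory.GaloisCohomology
open Literature.NumberTheory.EllipticCurves Literature.NumberTheory.EllipticCurves.ModularForms
open Literature.NumberTheory.EllipticCurves.Kato2004
open Literature.NumberTheory.EllipticCurves.Kato2004.EulerSystemValues
open Summit.BirchSwinnertonDyer.BirchSwinnertonDyer.Rank1Residual

namespace Summit.BirchSwinnertonDyer.BirchSwinnertonDyer.Theorems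

/-- **The crux `MuTransferX9` modulo its last registered stub and the four published named facts.**
Binders: `hfineZ` (Kato's §17.13 package with fine quotient and Thm. 12.6 span clause), `hred` (Kato
§13.8), `hPT` (Poitou–Tate over `ℚ`), `hEP` (local Euler–Poincaré characteristic), `hG34` (the registered
stub `stub_stepsTwoFourOdd` of skeleton v6d, verbatim).  Conclusion: the route decl BY NAME.
[cite: Kato2004Asterisque, Thm. 12.5, Thm. 12.6, §13.8, (14.9.3), §17.13] [cite: MilneADT2006, Ch. I, 2.8 and 4.10]
[cite: GreenbergVatsal2000, Prop. 3.7] -/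
theorem smallImageMuTransfer_MuTransferX9_of_stepsTwoFourOdd
    (hfineZ : exists_divisibilityInputs_fineQuotient_zeta) (hred : mem_pSmul_of_red_eq_zero)
    (hPT : poitouTate_sum_localTatePairing_eq_zero ℚ)
    (hEP : ∀ v : HeightOneSpectrum (𝓞 ℚ), localEulerPoincareCharacteristic (v.adicCompletion ℚ))
    (hG34 : ∀ (W : WeierstrassCurve ℚ) [W.IsElliptic] [W.IsGloballyMinimal] (p : ℕ) [Fact p.Prime] [ContinuousSMul ℤ_[p] (W.tateModule p)] [Module.Free ℤ_[p] (W.tateModule p)] [Module.Finite ℤ_[p] (W.tateModule p)] (κ : ZpExtension ℚ p) (γ : absoluteGaloisGroup ℚ) (I : IwasawaH1Data W p κ γ), p ≠ 2 → W.HasIrreducibleModPGaloisRep p → ¬ W.HasSurjectiveModNGaloisRep p → κ.IsCyclotomic → κ.IsTopGenerator γ → poitouTate_sum_localTatePairing_eq_zero ℚ → ∀ (s : I.H), IsEulerSystemClass W p κ γ I s → ∃ (S₀ : Set (HeightOneSpectrum (𝓞 ℚ))), S₀.Finite ∧ ∀ (a : ℕ) (κ' : κ.twistTower (W.torsionGaloisModule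 (p : ℤ)) (fun P : WeierstrassCurve.geomTorsion W (p : ℤ) => AddSubgroup.torsionBy.nsmul P)), (κ.towerShift (W.torsionGaloisModule (p : ℤ)) (fun P : WeierstrassCurve.geomTorsion W (p : ℤ) => AddSubgroup.torsionBy.nsmul P))^[a] κ' = I.redTower s → ∀ (n e' : ℕ), e' + 1 = p ^ n → ∀ (Φ : contOneCocycles (W.modPTwist p κ (2 * e' + 1 + 1)).toTopRep), oneCocycleClass (W.modPTwist p κ (2 * e' + 1 + 1)).toTopRep Φ = κ'.1 (2 * e' + 1 + 1) → ∀ (ε : ℕ) (S₁ : Set (HeightOneSpectrum (𝓞 ℚ))) (Ψ : galoisCohomology (W.modPTwist p κ.invTwist (2 * e' + 1 + 1)) 1) (Ψc : contOneCocycles (W.modPTwist p κ.invTwist (2 * e' + 1 + 1)).toTopRep), S₀ ⊆ S₁ → oneCocycleClass (W.modPTwist p κ.invTwist (2 * e' + 1 + 1)).toTopRep Ψc = Ψ → (∀ v : HeightOneSpectrum (𝓞 ℚ), v ∉ S₁ → galoisCohomology.localization (W.modPTwist p κ.invTwist (2 * e' + 1 + 1)) (Sum.inr v) 1 Ψ ∈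 DiscreteGaloisModule.unramifiedSubgroup (GaloisRep.toLocal v (W.modPTwist p κ.invTwist (2 * e' + 1 + 1))) 1) → (∀ v : HeightOneSpectrum (𝓞 ℚ), v ∈ S₁ → galoisCohomology.localization (W.modPTwist p κ.invTwist (2 * e' + 1 + 1)) (Sum.inr v) 1 ((κ.invTwist.shiftH1 (W.torsionGaloisModule (p : ℤ)) (fun P : WeierstrassCurve.geomTorsion W (p : ℤ) => AddSubgroup.torsionBy.nsmul P) (2 * e' + 1 + 1))^[ε] Ψ) = 0) → ∀ (eW : WeierstrassCurve.geomTorsion W (p : ℤ) → WeierstrassCurve.geomTorsion W (p : ℤ) → AlgebraicClosure ℚ) (hμ : ∀ S T, eW S T ^ p = 1) (hadd₁ : ∀ S₁' S₂' T, eW (S₁' + S₂') T = eW S₁' T * eW S₂' T) (hadd₂ : ∀ S T₁ T₂, eW S (T₁ + T₂) = eW S T₁ * eW S T₂), (∀ T, eW T T = 1) → (∀ T, (∀ S, eW S T = 1) → T = 0) → (∀ (σ : absoluteGaloisGroup ℚ) (S T : WeierstrassCurve.geomTorsion W (p : ℤ)), σ • eW S T = eW (σ • S) (σ • T)) → ∀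 (q : HeightOneSpectrum (𝓞 ℚ)), q ∉ S₁ → ∀ 𝔓 ∈ q.primesAbove, ∀ (Fr : absoluteGaloisGroup ℚ), IsArithFrobAt (𝓞 ℚ) Fr 𝔓 → WeierstrassCurve.galoisRepTorsion W p Fr = 1 → Fr ∈ κ.layerSubgroup n → Fr ∉ κ.layerSubgroup (n + 1) → ∃ U : Polynomial ℤ, ¬ ((p : ℤ) ∣ U.coeff 0) ∧ ∀ i : ℕ, i + ε < 2 * e' + 1 + 1 → convCoeff (weilPairingHom W p eW hμ hadd₁ hadd₂) (2 * e' + 1 + 1) i (Polynomial.aeval (shiftEnd (WeierstrassCurve.geomTorsion W (p : ℤ)) (2 * e' + 1 + 1)) U ((shiftEnd (WeierstrassCurve.geomTorsion W (p : ℤ)) (2 * e' + 1 + 1) ^ (e' + 1 + a)) (Φ.1 Fr))) (Ψc.1 Fr) = 0) :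
    Summit.BirchSwinnertonDyer.BirchSwinnertonDyer.Theses.SmallImageMuTransfer.MuTransferX9 := by
  unfold Summit.BirchSwinnertonDyer.BirchSwinnertonDyer.Theses.SmallImageMuTransfer.MuTransferX9
  intro W _ _ p _ N _ f hX9 hf hcert κ γ hκ hγ hγ' D
  haveI : ContinuousSMul ℤ_[p] (W.tateModule p) := TateModule.continuousSMul_padicInt
  haveI : Module.Free ℤ_[p] (W.tateModule p) := W.module_free_tateModule_holds p
  haveI : Module.Finite ℤ_[p] (W.tateModule p) := W.module_finite_tateModule_holds p
  obtain ⟨hnoCM, h5, hgood, hap, hirr, hnsurj⟩ := hX9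
  have hp2 : p ≠ 2 := by omega
  have hord : IsOrdinaryAt W p := ⟨hgood, hap⟩
  -- the pinned modules: `𝐇¹_Γ(T_pW)` (exists, Kato §12.2/§13.8 — PROVED) and `X₀(E/ℚ_∞)`
  obtain ⟨I⟩ := nonempty_iwasawaH1Data_holds W p κ γ hκ hγ
  obtain ⟨Y⟩ := W.nonempty_fineSelmerDualData κ hγ
  -- `X(E/ℚ_∞)` is finitely generated over `Λ` for the cyclotomic `κ` (Nakayama)
  haveI : Module.Finite (IwasawaAlgebra p) D.X :=
    WeierstrassCurve.SelmerDualData.module_finite_of_isCyclotomic W κ hκ D hγ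
  -- Kato's package with the fine quotient and the span clause (PUB binder `hfineZ`)
  obtain ⟨K, π, hπs, hπ, hZ⟩ := hfineZ W p f κ γ hp2 hord hκ hγ hγ' hf I D Y
  haveI : Module.Finite (IwasawaAlgebra p) Y.X := Module.Finite.of_surjective π hπs
  -- `L_p ∈ Λ` (GV Prop. 3.7) and the certificate: `G₁ ∉ (p)`
  obtain ⟨G₁, hG₁⟩ := exists_iwasawaToPowerSeries_eq_padicLFunction hp2 hord hf hirr
  have hμL : G₁ ∉ IwasawaAlgebra.augIdealP p := not_mem_augIdealP_of_norm_coeff_eq_one hG₁ hcert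
  -- §6 (i) with the Thm. 12.6 span clause: some GENUINE Euler-system class is not divisible by `p`
  obtain ⟨s, hs, hsp⟩ := exists_isEulerSystemClass_not_mem K hZ hirr hG₁ hμL
  -- Theorem A on the pinned objects: the kernel core (p452034) with the proved Selmer-side stub (p465845)
  obtain ⟨J, hJ⟩ :=
    CoreAssembly.stub_coreX9_of_selmerDualOdd_of_stepsTwoFourOdd hred hPT hEP
      SelmerDual.stub_selmerDualOdd_holds hG34 W p κ γ I
      ⟨hnoCM, h5, hgood, hap, hirr, hnsurj⟩ hκ hγ ⟨s, hs, hsp⟩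
  haveI : Finite (Y.X ⧸ (IwasawaAlgebra.augIdealP p • (⊤ : Submodule (IwasawaAlgebra p) Y.X))) :=
    Y.finite_quotient_augIdealP_of_finite_pTorsion
      (W.finite_fineSelmerInfty_pTorsion_of_forall_iterate_eq_zero κ hγ hJ)
  -- bookkeeping at `𝔭 = (p)`: `length X₀_𝔭 = 0 ⟹ length X_𝔭 = 0 ⟹ μ(X) = 0`
  let 𝔭 : PrimeSpectrum (IwasawaAlgebra p) :=
    ⟨IwasawaAlgebra.augIdealP p, IwasawaAlgebra.isPrime_augIdealP_holds p⟩
  have hY0 : Module.lengthAt (IwasawaAlgebra p) Y.X 𝔭 = 0 :=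
    Summit.BirchSwinnertonDyer.BirchSwinnertonDyer.Rank1Residual.KatoMuSkeleton.lengthAt_eq_zero_of_finite_quotient_p
      (M := Y.X) 𝔭 rfl
  have hX0 : Module.lengthAt (IwasawaAlgebra p) D.X 𝔭 = 0 :=
    le_antisymm ((lengthAt_X_le_lengthAt_fine K hirr hG₁ 𝔭
      (by exact IwasawaAlgebra.height_augIdealP_holds p) hμL π hπ).trans hY0.le) bot_le
  change muInvariant p D.X = 0
  rw [muInvariant_eq_toNat_lengthAt p D.X 𝔭 rfl, hX0]
  rfl

end Summit.BirchSwinnertonDyer.BirchSwinnertonDyer.Theorems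

end
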